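import Summits.MatrixMultiplication.MatrixMultiplication.Theorems.AbelianSTPPCensusFPQGenDefs
import Summits.MatrixMultiplication.MatrixMultiplication.Theorems.AbelianSTPPCensusRoomKneser

/-!
# Consumer lemmas of the FPq predicate (`FPQ.AdmG Λ`): heavy pairs, supports, Kneser in the label group — the «level-1» toolkit

Cell mm-stpp (rung F-M1), theory lane «past the walls» (seat mm-stpp-theory, gen 18).  Census-silent ENABLER.  A certificate against
`FPQ.AdmG Λ M a b c` (`AbelianSTPPCensusFPQGenDefs`; `Λ = ℤ/q`: `FPQ.AdmC`) has to refute the EXISTENCE of class-count functions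
`x, y, z : Λ → ℕ`; for `|Λ| ≥ 25` no box search over the values is feasible and the refutation has to argue with the POSITIONS of heavy, light
and empty classes in the label group (HOME/mm-stpp-theory/FPQ-NOTE.md §§4, 7).  This file derives, from the clauses of ONE letter form
`FormOKG Λ p cap vmin SU SV SW u v w`, the position statements such an argument starts from — all elementary, all about the predicate (no
group `H`, no STPP family):
* `targetOKG_eq_zero_of_heavy_pair` — (PH): a pair `(g, c − g)` with `u g + v (c − g) > p + cap` forces `w c = 0`;
* `formOKG_eq_zero_of_mem_levelSum` — hence `w` vanishes on the sumset `{α ≤ u} + {β ≤ v}` of two level sets with `α + β > p + cap`;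
* `formOKG_eq_zero_of_not_mem_suppSum` — (F3): `w` vanishes off `supp u + supp v` (every target point needs a representation);
* `formOKG_card_supp_add_card_levelSum_le` — so `#supp w + #({α ≤ u} + {β ≤ v}) ≤ |Λ|`;
* `formOKG_kneser_budget` — Kneser in `Λ` (tree `STPPRoomKneser.kneser_budget`) turns this into the divisor-indexed budget
  `∃ d ∣ |Λ|, d⌈s_α/d⌉ + d⌈t_β/d⌉ ≤ d⌊(|Λ| − #supp w)/d⌋ + d` for the level-set sizes `s_α, t_β ≥ 1`;
* `formOKG_total_le_of_supp`, `formOKG_total_le_tail` — mass bounds `SW ≤ p·#supp w`, `SU ≤ p·#{α ≤ u} + (α − 1)·(|Λ| − #{α ≤ u})`.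
WHAT THIS IS NOT: no certificate, no checker, no census number, no `ω` statement; lemmas about the shape-level predicate only.
-/

set_option linter.dupNamespace false -- `MatrixMultiplication.MatrixMultiplication` (summit = problem, D-0017)
set_option autoImplicit false

namespace Summit.MatrixMultiplication.MatrixMultiplication.Theorems

open Finset
open scoped Pointwise

namespace FPQ

variable {Λ : Type} [AddCommGroup Λ] [Fintype Λ] [DecidableEq Λ]
variable {p cap vmin SU SV SW : ℕ} {u v w : Λ → ℕ}

/-! ### Heavy pairs exclude the target (pigeonhole clause (PH)) -/

omit [DecidableEq Λ] in
/-- **(PH) read for one pair**: if the target class `c` is fed by a pair `(g, c − g)` with `u g + v (c − g) > p + cap` then it carries no target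
point (`W = 0`): that pair alone would represent every point of the class more than `cap` times. [original] -/
theorem targetOKG_eq_zero_of_heavy_pair {c : Λ} {W : ℕ} (hT : TargetOKG Λ p cap vmin u v c W) (g : Λ)
    (hg : p + cap < u g + v (c - g)) : W = 0 := by
  by_contra hW
  have h := hT.2.2.2.2 (Nat.one_le_iff_ne_zero.mpr hW)
  have hle : u g + v (c - g) - p ≤ ∑ g', (u g' + v (c - g') - p) :=
    single_le_sum (f := fun g' => u g' + v (c - g') - p) (fun _ _ => Nat.zero_le _) (mem_univ g)
  omega

/-- **Level sets**: `w` vanishes on the sumset `{g : α ≤ u g} + {h : β ≤ v h}` whenever `α + β > p + cap`. [original] -/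
theorem formOKG_eq_zero_of_mem_levelSum (hF : FormOKG Λ p cap vmin SU SV SW u v w) {α β : ℕ} (hαβ : p + cap < α + β) {c : Λ}
    (hc : c ∈ univ.filter (fun g => α ≤ u g) + univ.filter (fun h => β ≤ v h)) : w c = 0 := by
  rw [mem_add] at hc
  obtain ⟨g, hg, h, hh, rfl⟩ := hc
  rw [mem_filter] at hg hh
  refine targetOKG_eq_zero_of_heavy_pair (hF.2.2.2.2.2 (g + h)) g ?_
  rw [add_sub_cancel_left]
  omega

/-! ### Every target point needs a representation (clause (F3)) -/

/-- **(F3) read for supports**: `w` vanishes off `supp u + supp v` (with `vmin ≥ 1`: a target class needs a pair with both classes non-empty).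
[original] -/
theorem formOKG_eq_zero_of_not_mem_suppSum (hF : FormOKG Λ p cap vmin SU SV SW u v w) (hvmin : 1 ≤ vmin) {c : Λ}
    (hc : c ∉ univ.filter (fun g => 1 ≤ u g) + univ.filter (fun h => 1 ≤ v h)) : w c = 0 := by
  by_contra hW
  have h3 := (hF.2.2.2.2.2 c).2.2.2.1 (Nat.one_le_iff_ne_zero.mpr hW)
  have hpos : 0 < ∑ g, min (u g) (v (c - g)) := by omega
  obtain ⟨g, -, hg⟩ := exists_ne_zero_of_sum_ne_zero hpos.ne'
  apply hc
  rw [mem_add]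
  refine ⟨g, mem_filter.mpr ⟨mem_univ _, ?_⟩, c - g, mem_filter.mpr ⟨mem_univ _, ?_⟩, add_sub_cancel g c⟩
  · have := min_le_left (u g) (v (c - g)); omega
  · have := min_le_right (u g) (v (c - g)); omega

/-! ### Counting: supports, level-set sumsets, Kneser -/

/-- The support of `w` and the heavy sumset `{α ≤ u} + {β ≤ v}` (`α + β > p + cap`) are disjoint subsets of `Λ`:
`#supp w + #({α ≤ u} + {β ≤ v}) ≤ |Λ|`. [original] -/
theorem formOKG_card_supp_add_card_levelSum_le (hF : FormOKG Λ p cap vmin SU SV SW u v w) {α β : ℕ} (hαβ : p + cap < α + β) :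
    (univ.filter (fun c => 1 ≤ w c)).card + (univ.filter (fun g => α ≤ u g) + univ.filter (fun h => β ≤ v h)).card ≤ Fintype.card Λ := by
  rw [← card_union_of_disjoint]
  · exact (card_le_univ _)
  · rw [Finset.disjoint_left]
    intro c hc hc'
    have := formOKG_eq_zero_of_mem_levelSum hF hαβ hc'
    rw [mem_filter] at hc
    omega

/-- **Kneser budget for the heavy level sets.**  If both level sets `{α ≤ u}`, `{β ≤ v}` (`α + β > p + cap`) are non-empty, of sizes `s, t`, and
`supp w` has `n` classes, then for some divisor `d` of `|Λ|` (the order of the period of the sumset):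
`d⌈s/d⌉ + d⌈t/d⌉ ≤ d⌊(|Λ| − n)/d⌋ + d` (tree `STPPRoomKneser.kneser_budget`).  The case `d = 1` is `s + t ≤ |Λ| − n + 1`; large `d` confines the
level sets to few cosets of a subgroup of order `d` (the structural branch a certificate recurses on). [original] -/
theorem formOKG_kneser_budget (hF : FormOKG Λ p cap vmin SU SV SW u v w) {α β : ℕ} (hαβ : p + cap < α + β)
    (hS : (univ.filter (fun g => α ≤ u g)).Nonempty) (hT : (univ.filter (fun h => β ≤ v h)).Nonempty) :
    ∃ d : ℕ, d ∣ Fintype.card Λ ∧ 0 < d ∧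
      d * (((univ.filter (fun g => α ≤ u g)).card + d - 1) / d) + d * (((univ.filter (fun h => β ≤ v h)).card + d - 1) / d) ≤
        d * ((Fintype.card Λ - (univ.filter (fun c => 1 ≤ w c)).card) / d) + d :=
  STPPRoomKneser.kneser_budget _ _ hS hT _ (by have := formOKG_card_supp_add_card_levelSum_le hF hαβ; omega)

/-! ### Mass bounds -/

omit [DecidableEq Λ] in
/-- `SW ≤ p · #supp w` (every class carries at most `p` target points). [original] -/
theorem formOKG_total_le_of_supp (hF : FormOKG Λ p cap vmin SU SV SW u v w) :
    SW ≤ p * (univ.filter (fun c => 1 ≤ w c)).card := by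
  obtain ⟨-, -, hsum, -, -, hT⟩ := hF
  rw [← hsum, ← sum_filter_add_sum_filter_not univ (fun c => 1 ≤ w c)]
  have h1 : ∑ c ∈ univ.filter (fun c => 1 ≤ w c), w c ≤ p * (univ.filter (fun c => 1 ≤ w c)).card := by
    rw [mul_comm, ← smul_eq_mul, ← sum_const]
    exact sum_le_sum fun c _ => (hT c).1
  have h2 : ∑ c ∈ univ.filter (fun c => ¬ 1 ≤ w c), w c = 0 :=
    sum_eq_zero fun c hc => by have := (mem_filter.mp hc).2; omega
  omega

/-- Tail bound for a summand letter: `SU ≤ p·#{α ≤ u} + (α − 1)·(|Λ| − #{α ≤ u})` (classes `≤ p`; the others `< α`). [original] -/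
theorem formOKG_total_le_tail (hF : FormOKG Λ p cap vmin SU SV SW u v w) (α : ℕ) :
    SU ≤ p * (univ.filter (fun g => α ≤ u g)).card + (α - 1) * (Fintype.card Λ - (univ.filter (fun g => α ≤ u g)).card) := by
  obtain ⟨hsum, -, -, hu, -, -⟩ := hF
  rw [← hsum, ← sum_filter_add_sum_filter_not univ (fun g => α ≤ u g)]
  have h1 : ∑ g ∈ univ.filter (fun g => α ≤ u g), u g ≤ p * (univ.filter (fun g => α ≤ u g)).card := by
    rw [mul_comm, ← smul_eq_mul, ← sum_const]
    exact sum_le_sum fun g _ => hu g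
  have h2 : ∑ g ∈ univ.filter (fun g => ¬ α ≤ u g), u g ≤ (α - 1) * (univ.filter (fun g => ¬ α ≤ u g)).card := by
    rw [mul_comm, ← smul_eq_mul, ← sum_const]
    exact sum_le_sum fun g hg => by have := (mem_filter.mp hg).2; omega
  have h3 : (univ.filter (fun g => ¬ α ≤ u g)).card = Fintype.card Λ - (univ.filter (fun g => α ≤ u g)).card := by
    rw [filter_not, card_sdiff_of_subset (filter_subset _ _), card_univ]
  rw [h3] at h2
  omega

/-- The same tail bound for the second summand letter. [original] -/
theorem formOKG_total_le_tail' (hF : FormOKG Λ p cap vmin SU SV SW u v w) (β : ℕ) :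
    SV ≤ p * (univ.filter (fun h => β ≤ v h)).card + (β - 1) * (Fintype.card Λ - (univ.filter (fun h => β ≤ v h)).card) := by
  obtain ⟨-, hsum, -, -, hv, -⟩ := hF
  rw [← hsum, ← sum_filter_add_sum_filter_not univ (fun h => β ≤ v h)]
  have h1 : ∑ h ∈ univ.filter (fun h => β ≤ v h), v h ≤ p * (univ.filter (fun h => β ≤ v h)).card := by
    rw [mul_comm, ← smul_eq_mul, ← sum_const]
    exact sum_le_sum fun h _ => hv h
  have h2 : ∑ h ∈ univ.filter (fun h => ¬ β ≤ v h), v h ≤ (β - 1) * (univ.filter (fun h => ¬ β ≤ v h)).card := by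
    rw [mul_comm, ← smul_eq_mul, ← sum_const]
    exact sum_le_sum fun h hh => by have := (mem_filter.mp hh).2; omega
  have h3 : (univ.filter (fun h => ¬ β ≤ v h)).card = Fintype.card Λ - (univ.filter (fun h => β ≤ v h)).card := by
    rw [filter_not, card_sdiff_of_subset (filter_subset _ _), card_univ]
  rw [h3] at h2
  omega

end FPQ

end Summit.MatrixMultiplication.MatrixMultiplication.Theorems
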